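import Summits.QuantumAdvantage.QuantumAdvantage.Theorems.WhiteBoxWalkWbwThesisWeakOWDensity
import Summits.QuantumAdvantage.QuantumAdvantage.Theorems.WhiteBoxWalkWbwThesisWeakOWAdversary

/-!
# Route `WhiteBoxWalk`, crux `WbwThesis` (stmt-QuantumAdvantage-2238), line `Sketch`: `fPQ` is weakly one-way

`stub_weakOW` (part (C), the accounting): under the FACTORING ASSUMPTION every PPT inverter `B` of
the prime-pair product function `fPQ` fails with probability at least `1/qPQ(n) = 1/(32 n² + 32)` for
all large seed lengths `n` — exactly the weak one-wayness hypothesis `hweak` of the tree's Yao theorem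
`Yao.Params.isOneWay_g` for `pqParams`.

With `n = 2m + b` (`b ∈ {0,1}`), `π_m = #mbitPrimes m` and the factoring adversary `A_b` of part (B)
(`stub_weakOW_adversary`):

* ACCOUNTING at one length (`WeakOW.invertProb_le`): the `π_m²` hard-branch blocks
  `encW m P ++ encW m Q ++ 0ᵇ` (`P, Q` `m`-bit primes; pairwise distinct blocks, `WeakOW.block_injOn`)
  contribute at most `A_b`'s factoring successes `∑_P ∑_Q succ_{A_b}(m; P, Q) = π_m² · F_b(m)`
  (`F_b(m) = primePairAvg m succ_{A_b}`), every other seed at most `1`, so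
  `invertProb fPQ B n ≤ 1 - π_m² (1 - F_b(m)) / 2ⁿ`;
* the factoring assumption makes `F_b(m) → 0`, so eventually `F_b(m) ≤ 1/2` for both parities; the
  density of `m`-bit primes (part (A), `stub_weakOW_density`: `2^m ≤ 4 m π_m`) gives
  `π_m²/2ⁿ ≥ 1/(32 m²)`; hence `invertProb fPQ B n ≤ 1 - 1/(64 m²) ≤ 1 - 1/(32 n² + 32)` (`2m ≤ n`),
  eventually in `n` (`m = ⌊n/2⌋ → ∞`).

References: O. Goldreich, *Foundations of Cryptography I* (2001), §2.2.4.1 (`f_mult` is weakly one-way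
under the factoring assumption), Def. 2.2.2 (weak one-way functions).
-/

noncomputable section

set_option linter.dupNamespace false -- D-0017: single-problem summit ⇒ `QuantumAdvantage.QuantumAdvantage` by design

namespace Summit.QuantumAdvantage.QuantumAdvantage.Theorems.WhiteBoxWalk

open Summit.QuantumAdvantage.QuantumAdvantage.Theorems (FactoringAssumption mbitPrimes mem_mbitPrimes
  primePairAvg)
open Literature.Computability.Cryptography Literature.Computability.Complexity
open _root_.Computability Polynomial Filter Asymptotics Topology

namespace WeakOW

/-- The hard-branch blocks `encW m P ++ encW m Q ++ 0ᵇ` of distinct pairs of numbers below `2^m` are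
distinct (the width-`m` numerals are exact, `Canon.bitsToNat_encW`). [folklore] -/
theorem block_injOn (m : ℕ) (b : Bool) {P Q P' Q' : ℕ} (hP : P < 2 ^ m) (hQ : Q < 2 ^ m)
    (hP' : P' < 2 ^ m) (hQ' : Q' < 2 ^ m)
    (h : encW m P ++ encW m Q ++ List.replicate b.toNat false =
      encW m P' ++ encW m Q' ++ List.replicate b.toNat false) : P = P' ∧ Q = Q' := by
  have h1 := List.append_cancel_right h
  obtain ⟨h2, h3⟩ := List.append_inj h1 (by rw [length_encW, length_encW])
  refine ⟨?_, ?_⟩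
  · rw [← Canon.bitsToNat_encW hP, ← Canon.bitsToNat_encW hP', h2]
  · rw [← Canon.bitsToNat_encW hQ, ← Canon.bitsToNat_encW hQ', h3]

/-- **Accounting at one seed length `n = 2m + b`.** If `B`'s inversion probability on every
hard-branch block `encW m P ++ encW m Q ++ 0ᵇ` (`P, Q` `m`-bit primes) is at most `succ P Q`, then
`invertProb fPQ B n ≤ 1 - (π_m² - ∑_P ∑_Q succ P Q) / 2ⁿ`: the `π_m²` blocks are distinct seeds of
length `n` (`block_injOn`), and every other seed contributes at most `1`. [Goldreich 2001, §2.2.4.1] -/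
theorem invertProb_le {B : RandAlg (List Bool) (List Bool)} {b : Bool} {m : ℕ} {succ : ℕ → ℕ → ℝ}
    (hred : ∀ P ∈ mbitPrimes m, ∀ Q ∈ mbitPrimes m,
      B.pr id (boolPair (unaryEncodeNat (2 * m + b.toNat))
          (fPQ (encW m P ++ encW m Q ++ List.replicate b.toNat false)))
        {z | fPQ z = fPQ (encW m P ++ encW m Q ++ List.replicate b.toNat false)} ≤ succ P Q) :
    invertProb fPQ B (2 * m + b.toNat) ≤
      1 - (((mbitPrimes m).card : ℝ) ^ 2 - ∑ P ∈ mbitPrimes m, ∑ Q ∈ mbitPrimes m, succ P Q) /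
        2 ^ (2 * m + b.toNat) := by
  classical
  set n := 2 * m + b.toNat with hn
  set S := mbitPrimes m with hS
  -- the seeds and the hard-branch blocks as seeds
  set g : List Bool → ℝ := fun x => B.pr id (boolPair (unaryEncodeNat n) (fPQ x)) {z | fPQ z = fPQ x} with hg
  have hlen : ∀ pq : ℕ × ℕ, (encW m pq.1 ++ encW m pq.2 ++ List.replicate b.toNat false).length = n := by
    intro pq
    simp only [List.length_append, length_encW, List.length_replicate, hn]
    ring
  set ι : ℕ × ℕ → List.Vector Bool n := fun pq => ⟨_, hlen pq⟩ with hι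
  have hlt : ∀ p ∈ S, p < 2 ^ m := fun p hp => (mem_mbitPrimes.1 hp).2.2
  have hinj : ∀ pq ∈ S ×ˢ S, ∀ pq' ∈ S ×ˢ S, ι pq = ι pq' → pq = pq' := by
    rintro ⟨P, Q⟩ hpq ⟨P', Q'⟩ hpq' h
    rw [Finset.mem_product] at hpq hpq'
    have h' := congrArg List.Vector.toList h
    obtain ⟨h1, h2⟩ := block_injOn m b (hlt _ hpq.1) (hlt _ hpq.2) (hlt _ hpq'.1) (hlt _ hpq'.2) h'
    exact Prod.ext h1 h2
  set T := (S ×ˢ S).image ι with hT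
  have hcardT : T.card = S.card * S.card := by
    rw [hT, Finset.card_image_of_injOn (fun pq hpq pq' hpq' h => hinj pq hpq pq' hpq' h), Finset.card_product]
  -- the sum over all seeds, split along `T`
  have hg1 : ∀ x, g x ≤ 1 := fun x => RandAlg.pr_le_one _ _ _ _
  have hsumT : ∑ x ∈ T, g x.toList ≤ ∑ P ∈ S, ∑ Q ∈ S, succ P Q := by
    rw [hT, Finset.sum_image hinj, ← Finset.sum_product']
    refine Finset.sum_le_sum fun pq hpq => ?_
    rw [Finset.mem_product] at hpq
    exact hred pq.1 hpq.1 pq.2 hpq.2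
  have hsumC : ∑ x ∈ Tᶜ, g x.toList ≤ (2 : ℝ) ^ n - S.card ^ 2 := by
    calc ∑ x ∈ Tᶜ, g x.toList ≤ ∑ _x ∈ Tᶜ, (1 : ℝ) := Finset.sum_le_sum fun x _ => hg1 _
      _ = (Tᶜ.card : ℝ) := by simp
      _ = (2 : ℝ) ^ n - S.card ^ 2 := by
        have hle : T.card ≤ Fintype.card (List.Vector Bool n) := Finset.card_le_univ T
        rw [Finset.card_compl, Nat.cast_sub hle, card_vector, Fintype.card_bool, hcardT]
        push_cast
        ring
  have hsum : ∑ x : List.Vector Bool n, g x.toList ≤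
      ∑ P ∈ S, ∑ Q ∈ S, succ P Q + ((2 : ℝ) ^ n - S.card ^ 2) := by
    rw [← Finset.sum_add_sum_compl T]
    exact add_le_add hsumT hsumC
  -- conclusion
  have h2n : (0 : ℝ) < 2 ^ n := by positivity
  show (∑ x : List.Vector Bool n, g x.toList) / 2 ^ n ≤ _
  rw [one_sub_div h2n.ne']
  exact div_le_div_of_nonneg_right (by linarith) h2n.le

end WeakOW

/-- **`fPQ` is weakly one-way under the factoring assumption** (line `Sketch`, stub `stub_weakOW`), in
exactly the shape consumed by `Yao.Params.isOneWay_g`: for every PPT inverter `B`, eventually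
`invertProb fPQ B n ≤ 1 - 1/qPQ(n)`, `qPQ(n) = 32 n² + 32`.  With `n = 2m + b`: the accounting
`WeakOW.invertProb_le` fed with the factoring adversaries `A_b` of `stub_weakOW_adversary` gives
`invertProb fPQ B n ≤ 1 - π_m²(1 - F_b(m))/2ⁿ`, where `F_b(m)`, the average factoring success of `A_b`
on products of two uniform `m`-bit primes, tends to `0` by the factoring assumption; with the prime
density `2^m ≤ 4 m π_m` (`stub_weakOW_density`) this is eventually `≤ 1 - 1/(64 m²) ≤ 1 - 1/(32 n² + 32)`.
(The hypothesis `fPQ ∈ FP` is part of the registered signature; the reduction does not evaluate `fPQ`.)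
[Goldreich 2001, §2.2.4.1, Def. 2.2.2] -/
theorem stub_weakOW (hF : FactoringAssumption) (hf : PolyTimeComputable id id fPQ) :
    ∀ B : RandAlg (List Bool) (List Bool), IsPPT B id →
      ∀ᶠ n in atTop, invertProb fPQ B n ≤ 1 - 1 / ((qPQ.eval n : ℕ) : ℝ) := by
  have _hf := hf -- the registered signature carries `fPQ ∈ FP`; the reduction never evaluates `fPQ`
  intro B hB
  -- one factoring adversary per parity of the seed length
  choose A hA hred using fun b : Bool => stub_weakOW_adversary hB b
  obtain ⟨F, hFdef⟩ : ∃ F : Bool → ℕ → ℝ, ∀ b m, F b m = primePairAvg m fun p q =>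
      (A b).pr id (boolPair (unaryEncodeNat m) (encodeNat (p * q))) {y | encodeNat (min p q) <+: y} :=
    ⟨_, fun _ _ => rfl⟩
  have hF0 : ∀ b, Tendsto (F b) atTop (𝓝 0) := fun b => by
    have h := hF (A b) (hA b) 0
    simpa only [pow_zero, one_mul, ← hFdef] using h
  have hFev : ∀ᶠ m in atTop, ∀ b, F b m < 1 / 2 :=
    eventually_all.2 fun b => (hF0 b).eventually (gt_mem_nhds (by norm_num))
  -- eventually in `m = ⌊n/2⌋ → ∞`
  have htend : Tendsto (fun n : ℕ => n / 2) atTop atTop :=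
    tendsto_atTop_atTop.2 fun k => ⟨2 * k, fun n hn => by omega⟩
  have hev := htend.eventually (hFev.and (stub_weakOW_density.and (eventually_ge_atTop 1)))
  filter_upwards [hev] with n hn
  obtain ⟨hFn, hdens, hm1⟩ := hn
  -- the parity bit and `m = ⌊n/2⌋`
  obtain ⟨b, hb⟩ : ∃ b : Bool, n = 2 * (n / 2) + b.toNat := by
    rcases Nat.mod_two_eq_zero_or_one n with h | h
    · exact ⟨false, by rw [Bool.toNat_false]; omega⟩
    · exact ⟨true, by rw [Bool.toNat_true]; omega⟩
  generalize hm : n / 2 = m at hFn hdens hm1 hb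
  -- the accounting at length `n`
  have key := WeakOW.invertProb_le (hred b m hm1)
  rw [← hb] at key
  -- `π_m > 0` (density) and `∑∑ succ = F_b(m) · π_m²`
  have hcard : 0 < (mbitPrimes m).card := by
    rcases Nat.eq_zero_or_pos (mbitPrimes m).card with h | h
    · exfalso
      rw [h, Nat.cast_zero, mul_zero] at hdens
      exact absurd hdens (not_le.2 (by positivity))
    · exact h
  have hsum : ∑ P ∈ mbitPrimes m, ∑ Q ∈ mbitPrimes m,
      (A b).pr id (boolPair (unaryEncodeNat m) (encodeNat (P * Q))) {y | encodeNat (min P Q) <+: y} =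
        F b m * ((mbitPrimes m).card : ℝ) ^ 2 := by
    rw [hFdef, primePairAvg, div_mul_cancel₀]
    exact pow_ne_zero 2 (Nat.cast_ne_zero.2 hcard.ne')
  rw [hsum] at key
  generalize hs : ((mbitPrimes m).card : ℝ) = s at key hdens
  have hs0 : 0 < s := by rw [← hs]; exact_mod_cast hcard
  have hFb := hFn b
  have hq : (((qPQ.eval n : ℕ) : ℝ)) = 32 * (n : ℝ) ^ 2 + 32 := by
    simp [qPQ]
  rw [hq]
  refine key.trans (sub_le_sub_left ?_ 1)
  -- `1/(32 n² + 32) ≤ (s² - F s²)/2ⁿ`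
  have h2m : (2 * m : ℝ) ≤ n := by exact_mod_cast (show 2 * m ≤ n by omega)
  have hb1 : b.toNat ≤ 1 := Bool.toNat_le b
  have hpow : (2 : ℝ) ^ n ≤ 2 * ((2 : ℝ) ^ m) ^ 2 :=
    calc (2 : ℝ) ^ n ≤ 2 ^ (2 * m + 1) := pow_le_pow_right₀ one_le_two (by omega)
      _ = 2 * ((2 : ℝ) ^ m) ^ 2 := by ring
  have hsq : ((2 : ℝ) ^ m) ^ 2 ≤ (4 * m * s) ^ 2 := pow_le_pow_left₀ (by positivity) hdens 2
  have h2n : (2 : ℝ) ^ n ≤ 32 * (m : ℝ) ^ 2 * s ^ 2 := by nlinarith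
  rw [div_le_div_iff₀ (by positivity) (by positivity), one_mul]
  have h1F : s ^ 2 / 2 ≤ s ^ 2 - F b m * s ^ 2 := by nlinarith [sq_nonneg s]
  have h4 : (4 : ℝ) * (m : ℝ) ^ 2 ≤ (n : ℝ) ^ 2 := by nlinarith [h2m]
  have hA' : s ^ 2 * (4 * (m : ℝ) ^ 2) ≤ s ^ 2 * (n : ℝ) ^ 2 := mul_le_mul_of_nonneg_left h4 (sq_nonneg s)
  have hms : 0 ≤ (m : ℝ) ^ 2 * s ^ 2 := by positivity
  calc (2 : ℝ) ^ n ≤ 32 * (m : ℝ) ^ 2 * s ^ 2 := h2n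
    _ ≤ s ^ 2 / 2 * (32 * (n : ℝ) ^ 2 + 32) := by nlinarith [sq_nonneg s]
    _ ≤ (s ^ 2 - F b m * s ^ 2) * (32 * (n : ℝ) ^ 2 + 32) :=
      mul_le_mul_of_nonneg_right h1F (by positivity)

end Summit.QuantumAdvantage.QuantumAdvantage.Theorems.WhiteBoxWalk

end
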